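import Mathlib
import HarnessLib
import Summits.Ventures.LatticeQCDFlow.Scaling.AR1SwitchingLaw

/-!
# AR1SwitchingRefinement — refining the protocol at a fixed relaxation budget never hurts: halving
# the step (twice the switches, half the relaxation each, `ρ ↦ √ρ`) multiplies the leading-order
# cost `k′ × (relaxation per step)` by `(1 + √ρ)²/(2(1 + ρ)) ∈ [1/2, 1)`

HONEST FRAMING: exact (Metropolis-corrected) sampling algorithms for lattice gauge theory;
figures of merit are autocorrelation/cost numbers at stated couplings and volumes; no
continuum-physics claim.

Venture `LatticeQCDFlow` (cell pub-lqcd), topic `Scaling`; FANOUT row 19 (`su2-snf`, GEN-4).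
OUR WORK, elementary algebra over `Scaling/AR1SwitchingLaw` (`kPrime Δ ρ = Δ²(1+ρ)/(1−ρ)`, the
model's `k′`: `−log ESS = k′ n_dof/n_step + O(n_dof/n_step²)`); nothing is cited as a fact.

THE QUESTION (E7 §4–§5: "a more efficient coupling layer that further reduces the cost in units of
`n_step`"; row 19's grid `n_step ∈ {½, 1, 2} × k′ n_dof` and row 13's defect-ball lever): at a FIXED
relaxation budget per evolution — `T = n_step × s` elementary relaxation units, each unit an
autoregression by `r`, so `s` units per step give `ρ = r^s` — is it better to switch rarely and
relax much per step, or to switch often and relax little?  In the AR(1) model the leading-order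
`−log ESS` is `n_dof · k′(ρ) / n_step = (n_dof Δ²/T) · [s (1 + r^s)/(1 − r^s)]`, so the comparison
between a protocol and its REFINEMENT (twice the steps, `s/2` units each: `ρ ↦ q` with `q² = ρ`) is
the comparison of `k′(q²)·s` with `k′(q)·s/2`.

* `kPrime_half_eq_factor_mul` — the exact identity `k′(q)/2 = [(1+q)²/(2(1+q²))] · k′(q²)`;
* `refinementFactor_le_one`, `refinementFactor_lt_one`, `half_le_refinementFactor` — the factor
  `(1+q)²/(2(1+q²))` is `≤ 1` always (`= 1` iff `q = 1`), `< 1` for `q ≠ 1`, and `≥ 1/2` for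
  `q ≥ 0` (`= 1/2` at `q = 0`);
* **`kPrime_refine_le`**, **`kPrime_refine_lt`** — hence for `0 ≤ q < 1` and a budget `s ≥ 0`:
  `k′(q)·(s/2) ≤ k′(q²)·s`, strictly for `Δ ≠ 0`, `s > 0`: REFINING NEVER HURTS and gains up to a
  factor `2` per halving when the per-step relaxation is strong (`ρ = q²` small), nothing when it is
  weak (`ρ → 1`: the factor `→ 1`) — to leading order in `1/n_step`; the `O(n_dof/n_step²)`
  corrections of `AR1SwitchingLaw.ar1NegLogESS_eq` are not compared here.

Reading (value-free, a property of the model): the advantage of interleaving MANY cheap partial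
updates with small switches over FEW full sweeps with large switches is generic for positively
autocorrelated layers, bounded by `2×` per halving, and vanishes as the layer decorrelates slowly;
it says nothing about which partial update a lattice code can afford (a fraction of a heat-bath sweep
is not an autoregression by `√ρ` of the defect plaquette — NOT CLAIMED).
-/

namespace Summit.Ventures.LatticeQCDFlow.Scaling

/-- The refinement factor `(1 + q)²/(2(1 + q²))`. -/
noncomputable def refinementFactor (q : ℝ) : ℝ := (1 + q) ^ 2 / (2 * (1 + q ^ 2))

/-- **The exact identity** `k′(q)/2 = refinementFactor q · k′(q²)` (`q ≠ ±1`). -/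
theorem kPrime_half_eq_factor_mul (Δ : ℝ) {q : ℝ} (hq : q ≠ 1) (hq' : q ≠ -1) :
    kPrime Δ q / 2 = refinementFactor q * kPrime Δ (q ^ 2) := by
  unfold kPrime refinementFactor
  have h1 : (1 : ℝ) - q ≠ 0 := sub_ne_zero.mpr (Ne.symm hq)
  have h2 : (1 : ℝ) + q ≠ 0 := by
    intro h; apply hq'; linarith
  have h3 : (1 : ℝ) - q ^ 2 ≠ 0 := by
    have : (1 : ℝ) - q ^ 2 = (1 - q) * (1 + q) := by ring
    rw [this]; exact mul_ne_zero h1 h2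
  have h4 : (1 : ℝ) + q ^ 2 ≠ 0 := by positivity
  field_simp
  ring

/-- The factor never exceeds one: `(1+q)² ≤ 2(1+q²)` iff `0 ≤ (1−q)²`. -/
theorem refinementFactor_le_one (q : ℝ) : refinementFactor q ≤ 1 := by
  unfold refinementFactor
  rw [div_le_one (by positivity)]
  nlinarith [sq_nonneg (1 - q)]

/-- … strictly below one unless `q = 1`. -/
theorem refinementFactor_lt_one {q : ℝ} (hq : q ≠ 1) : refinementFactor q < 1 := by
  unfold refinementFactor
  rw [div_lt_one (by positivity)]
  have : 0 < (1 - q) ^ 2 := by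
    have : (1 - q) ≠ 0 := sub_ne_zero.mpr (Ne.symm hq)
    positivity
  nlinarith

/-- … and at least one half for `q ≥ 0` (`= 1/2` at `q = 0`, perfect relaxation per unit). -/
theorem half_le_refinementFactor {q : ℝ} (hq : 0 ≤ q) : 1 / 2 ≤ refinementFactor q := by
  unfold refinementFactor
  rw [div_le_div_iff₀ (by norm_num) (by positivity)]
  nlinarith

/-- `refinementFactor 0 = 1/2`: with perfectly relaxing units, halving the step halves the cost. -/
@[simp] theorem refinementFactor_zero : refinementFactor 0 = 1 / 2 := by
  norm_num [refinementFactor]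

/-- **Refining never hurts (leading order).**  For `0 ≤ q < 1` and a relaxation budget `s ≥ 0` per
original step: `k′(q)·(s/2) ≤ k′(q²)·s` — the refined protocol (twice the switches, autoregression
`q` per half-step) is at most as costly as the coarse one (autoregression `ρ = q²` per step). -/
theorem kPrime_refine_le (Δ : ℝ) {q : ℝ} (hq0 : 0 ≤ q) (hq1 : q < 1) {s : ℝ} (hs : 0 ≤ s) :
    kPrime Δ q * (s / 2) ≤ kPrime Δ (q ^ 2) * s := by
  have hid := kPrime_half_eq_factor_mul Δ hq1.ne (by linarith)
  have hk : 0 ≤ kPrime Δ (q ^ 2) :=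
    kPrime_nonneg Δ (by nlinarith) (by nlinarith)
  calc kPrime Δ q * (s / 2) = (kPrime Δ q / 2) * s := by ring
    _ = refinementFactor q * kPrime Δ (q ^ 2) * s := by rw [hid]
    _ ≤ 1 * kPrime Δ (q ^ 2) * s := by
        gcongr
        exact refinementFactor_le_one q
    _ = kPrime Δ (q ^ 2) * s := by ring

/-- … and STRICTLY helps for `Δ ≠ 0`, `s > 0`: the gain factor is `refinementFactor q < 1`. -/
theorem kPrime_refine_lt {Δ : ℝ} (hΔ : Δ ≠ 0) {q : ℝ} (hq0 : 0 ≤ q) (hq1 : q < 1) {s : ℝ}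
    (hs : 0 < s) : kPrime Δ q * (s / 2) < kPrime Δ (q ^ 2) * s := by
  have hid := kPrime_half_eq_factor_mul Δ hq1.ne (by linarith)
  have hk : 0 < kPrime Δ (q ^ 2) := by
    unfold kPrime
    have hq2 : q ^ 2 < 1 := by nlinarith
    exact mul_pos (by positivity) (div_pos (by positivity) (by linarith))
  calc kPrime Δ q * (s / 2) = (kPrime Δ q / 2) * s := by ring
    _ = refinementFactor q * (kPrime Δ (q ^ 2) * s) := by rw [hid]; ring
    _ < 1 * (kPrime Δ (q ^ 2) * s) :=
        mul_lt_mul_of_pos_right (refinementFactor_lt_one hq1.ne) (mul_pos hk hs)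
    _ = kPrime Δ (q ^ 2) * s := one_mul _

/-- The gain in closed form: `k′(q)·(s/2) = refinementFactor q · (k′(q²)·s)`, with
`1/2 ≤ refinementFactor q < 1` on `0 ≤ q < 1` — at most a factor two per halving. -/
theorem kPrime_refine_eq (Δ : ℝ) {q : ℝ} (hq0 : 0 ≤ q) (hq1 : q < 1) (s : ℝ) :
    kPrime Δ q * (s / 2) = refinementFactor q * (kPrime Δ (q ^ 2) * s)
      ∧ 1 / 2 ≤ refinementFactor q ∧ refinementFactor q < 1 := by
  refine ⟨?_, half_le_refinementFactor hq0, refinementFactor_lt_one hq1.ne⟩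
  rw [← mul_assoc, ← kPrime_half_eq_factor_mul Δ hq1.ne (by linarith)]
  ring

end Summit.Ventures.LatticeQCDFlow.Scaling
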